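import Literature.NumberTheory.BeurlingPrimes.IntegerContinuation
import Literature.NumberTheory.BeurlingPrimes.HilberdinkJumps
import HarnessLib

/-!
# Hilberdink 2007, Theorem 1 (lower bound for the Lindelöf function): discharge of `Hilberdink2007_thm1`

Topic `Literature/NumberTheory/BeurlingPrimes`; sibling proofs file of `WellBehavedIntegers.lean` (which
cannot hold the proof itself: `IntegerContinuation.lean` imports it). Everything in this file is
PROVED; it DISCHARGES the named fact
`Literature.NumberTheory.BeurlingPrimes.Hilberdink2007_thm1` (`Hilberdink2007_thm1_holds`):

> **Theorem 1** (Hilberdink 2007). Let `𝒫` be a g-prime system for which `N_𝒫(x) = ρx + O(x^β)`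
> for some `β < 1/2` and `ρ > 0`. Then for `σ > β`, `μ_𝒫(σ) ≥ μ₀(σ)` (`μ₀(σ) = 1/2 − σ` for
> `σ < 1/2`),

vendored (for the non-trivial range `β < σ < 1/2`) as: for every analytic continuation `Z` of `ζ_𝒫`
to `{Re s > β} ∖ {1}`, every `l < 1/2 − σ` and all `C`, `T`, there is `|t| ≥ T` with
`‖Z(σ+it)‖ > C|t|^l`.

## The proof

Hilberdink's printed proof (pp. 338–340) truncates Perron's formula for the partial sums
`ζ_N(σ+it) = Σ_{n ≤ N} n^{−σ−it}`, pushes the contour to `Re w = −η`, and plays the hypothetical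
bound `ζ_𝒫(σ+it) = O(|t|^{1/2−σ−δ})` against the mean-value lower bound
`Σ_{r ≤ R} ∫₀^{2r−1} |ζ_N(σ+it)|² dt ≥ c₂R²N^{1−2σ}` of Hilberdink 2005 ("the same methods (but
strengthened) as those used in [4]"). The tree formalised the analytic core of Hilberdink 2005,
Theorem 1 in an `L²` (Mellin–Plancherel) form which is ALREADY of the 2007 strength:
`Hilberdink.false_of_mellin_bound` (`HilberdinkJumps.lean`) — for `a > 0`, `|N_𝒫(x) − ax| ≤ Cx^θ`
(`x ≥ 1`), `0 ≤ θ < σ₁`, and ANY `ε > 0` with `σ₁ + ε < 1/2`, the bound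
`‖∫₁^∞ E(x)x^{−σ₁−1+it} dx‖ ≤ K(1+|t|)^{ε−1}` for all real `t` is impossible (the jumps of `N_𝒫`
give `2π∫₀^∞‖G_ρ‖²x^{−2σ₁−1} ≫ X^{−2σ₁}` for the dilation difference `G_ρ` of `E`, `ρ = e^{c₀/X}`,
while Plancherel and the bound give `≪ X^{−2γ}`, `σ₁ < γ < 1/2 − ε`). So here we only transfer a
hypothetical polynomial bound on the continuation to the error Mellin transform:

* `Z` agrees on `{Re s > β} ∖ {1}` with Landau's continuation
  `intZeta ρ s = ρs/(s−1) + s·∫₁^∞ E(x)x^{−s−1} dx` (`IsZetaContinuation.eqOn`,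
  `isZetaContinuation_intZeta`, tree `IntegerContinuation.lean`), so on `Re s = σ`
  `∫₁^∞ E x^{−s−1} dx = (Z(s) − ρs/(s−1))/s`;
* if `‖Z(σ+it)‖ ≤ C|t|^l` for `|t| ≥ T`, then with `ε = max(l, (1/2−σ)/2) ∈ (0, 1/2 − σ)`:
  for `|t| ≥ max(T,1)` the transform is `≤ (|C| + 2ρ)|t|^{ε−1} ≤ 2(|C|+2ρ)(1+|t|)^{ε−1}`
  (`Hilberdink.norm_mellin_errN_le_of_zeta_bound`), and for `|t| ≤ max(T,1)` it is
  `≤ C_N/(σ−β)` (`Hilberdink.norm_mellin_errN_le`) `≤ (C_N/(σ−β))(1+max(T,1))^{1−ε}(1+|t|)^{ε−1}`;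
* `β ≥ 0` automatically (`not_intErrorLE_of_neg`, tree `IntCountBasic.lean`), and
  `false_of_mellin_bound` (with `a = ρ`, `θ = β`, `σ₁ = σ`) ends the proof.

## References
* [Hilberdink2007] T. W. Hilberdink, *A lower bound for the Lindelöf function associated to
  generalized integers*, J. Number Theory 122 (2007) 336–341, doi:10.1016/j.jnt.2006.05.007 (read in
  full: Theorem 1, p. 338, and its proof, pp. 338–340).
* [Hilberdink2005] T. W. Hilberdink, *Well-behaved Beurling primes and integers*, J. Number Theory
  112 (2005) 332–344, §3 (proof of Theorem 1; tree `Hilberdink*.lean`).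
-/

noncomputable section

open Complex Filter Set

namespace Literature.NumberTheory.BeurlingPrimes

open Literature.Barriers.RiemannHypothesis

namespace Hilberdink

/-- `|t|^{ε−1} ≤ 2(1+|t|)^{ε−1}` for `|t| ≥ 1`, `0 ≤ ε ≤ 1`. [folklore] -/
theorem rpow_sub_one_le_two_mul {t ε : ℝ} (ht : 1 ≤ |t|) (hε0 : 0 ≤ ε) (hε1 : ε ≤ 1) :
    |t| ^ (ε - 1) ≤ 2 * (1 + |t|) ^ (ε - 1) := by
  have ht0 : 0 < |t| := by linarith
  -- `(1+|t|)^{ε−1} ≥ (2|t|)^{ε−1} = 2^{ε−1}|t|^{ε−1} ≥ |t|^{ε−1}/2`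
  have h1 : (2 * |t|) ^ (ε - 1) ≤ (1 + |t|) ^ (ε - 1) :=
    Real.rpow_le_rpow_of_nonpos (by linarith) (by linarith) (by linarith)
  have h2 : (2 * |t|) ^ (ε - 1) = 2 ^ (ε - 1) * |t| ^ (ε - 1) :=
    Real.mul_rpow (by norm_num) ht0.le
  have h3 : (1 / 2 : ℝ) ≤ 2 ^ (ε - 1) := by
    rw [Real.rpow_sub_one (by norm_num : (2 : ℝ) ≠ 0)]
    have : (1 : ℝ) ≤ 2 ^ ε := Real.one_le_rpow (by norm_num) hε0
    linarith [show (2 : ℝ) ^ ε / 2 ≥ 1 / 2 from by linarith]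
  have h4 : 0 ≤ |t| ^ (ε - 1) := Real.rpow_nonneg ht0.le _
  nlinarith

/-- **From a polynomial bound on the continuation to a bound on the error Mellin transform.**
If `Z` agrees with Landau's continuation `intZeta ρ` (`ρ ≥ 0`) on the line `Re s = σ` and
`‖Z(σ+it)‖ ≤ C|t|^l` for `|t| ≥ T`, then for `|t| ≥ max(T,1)` and every `ε` with `l ≤ ε`,
`0 ≤ ε ≤ 1`: `‖mellin E (−σ + it)‖ = ‖∫₁^∞ E(x)x^{−σ−1+it} dx‖ ≤ 2(|C| + 2ρ)(1+|t|)^{ε−1}`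
(`E = errN P ρ = N_P − ρx` on `(1,∞)`) — because `s·mellin E (−s) = Z(s) − ρs/(s−1)` at
`s = σ − it`, `‖ρs/(s−1)‖ ≤ 2ρ` and `‖s‖ ≥ |t| ≥ 1`. (The step "using the hypothetical bound
`ζ_𝒫(σ+it) = O(|t|^{1/2−σ−δ})`" of the printed proof, in the tree's Mellin form.)
[cite: Hilberdink2007, Theorem 1 (proof)] -/
theorem norm_mellin_errN_le_of_zeta_bound {P : BeurlingPrimes} {ρ σ l ε C T : ℝ} (hρ : 0 ≤ ρ)
    {Z : ℂ → ℂ} (hZ : ∀ t : ℝ, Z (σ + t * I) = P.intZeta ρ (σ + t * I))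
    (hb : ∀ t : ℝ, T ≤ |t| → ‖Z (σ + t * I)‖ ≤ C * |t| ^ l)
    (hlε : l ≤ ε) (hε0 : 0 ≤ ε) (hε1 : ε ≤ 1) {t : ℝ} (hT : T ≤ |t|) (ht : 1 ≤ |t|) :
    ‖mellin (errN P ρ) (-σ + t * I)‖ ≤ 2 * (|C| + 2 * ρ) * (1 + |t|) ^ (ε - 1) := by
  -- the point `s = σ − it`, with `−s = −σ + it`
  set s : ℂ := σ + ((-t : ℝ) : ℂ) * I with hs
  have hsneg : -s = -σ + t * I := by rw [hs]; push_cast; ring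
  have hsim : s.im = -t := by simp [hs]
  have ht0 : 0 < |t| := by linarith
  have hs_norm : |t| ≤ ‖s‖ := by
    have h := abs_im_le_norm s
    rwa [hsim, abs_neg] at h
  have hs0 : 0 < ‖s‖ := lt_of_lt_of_le ht0 hs_norm
  -- `s · mellin E (−s) = Z(s) − ρs/(s−1)`
  have hZs : Z s = ρ * s / (s - 1) + s * mellin (errN P ρ) (-s) := by
    have := hZ (-t); rwa [BeurlingPrimes.intZeta] at this
  have hmel : s * mellin (errN P ρ) (-s) = Z s - ρ * s / (s - 1) := by rw [hZs]; ring
  -- bounds on the two pieces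
  have hZb : ‖Z s‖ ≤ |C| * |t| ^ ε := by
    have h1 : ‖Z s‖ ≤ C * |(-t)| ^ l := hb (-t) (by rwa [abs_neg])
    rw [abs_neg] at h1
    have h2 : C * |t| ^ l ≤ |C| * |t| ^ l :=
      mul_le_mul_of_nonneg_right (le_abs_self C) (Real.rpow_nonneg ht0.le _)
    have h3 : |t| ^ l ≤ |t| ^ ε := Real.rpow_le_rpow_of_exponent_le ht hlε
    have h4 : |C| * |t| ^ l ≤ |C| * |t| ^ ε := mul_le_mul_of_nonneg_left h3 (abs_nonneg C)
    linarith
  have hpole : ‖(ρ : ℂ) * s / (s - 1)‖ ≤ 2 * ρ * |t| ^ ε := by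
    have h1 : ‖(ρ : ℂ) * s / (s - 1)‖ ≤ 2 * ρ :=
      norm_pole_term_le hρ (by rw [hsim, abs_neg]; exact ht)
    have h2 : (1 : ℝ) ≤ |t| ^ ε := Real.one_le_rpow ht hε0
    nlinarith
  -- `‖s‖ ‖mellin‖ ≤ (|C| + 2ρ)|t|^ε`, hence `‖mellin‖ ≤ (|C| + 2ρ)|t|^{ε−1}`
  have hprod : ‖s‖ * ‖mellin (errN P ρ) (-s)‖ ≤ (|C| + 2 * ρ) * |t| ^ ε := by
    rw [← norm_mul, hmel]
    calc ‖Z s - ρ * s / (s - 1)‖ ≤ ‖Z s‖ + ‖(ρ : ℂ) * s / (s - 1)‖ := norm_sub_le _ _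
      _ ≤ |C| * |t| ^ ε + 2 * ρ * |t| ^ ε := add_le_add hZb hpole
      _ = (|C| + 2 * ρ) * |t| ^ ε := by ring
  have hm0 : 0 ≤ ‖mellin (errN P ρ) (-s)‖ := norm_nonneg _
  have hdiv : ‖mellin (errN P ρ) (-s)‖ ≤ (|C| + 2 * ρ) * |t| ^ (ε - 1) := by
    rw [Real.rpow_sub_one ht0.ne', ← mul_div_assoc, le_div_iff₀ ht0]
    calc ‖mellin (errN P ρ) (-s)‖ * |t| ≤ ‖mellin (errN P ρ) (-s)‖ * ‖s‖ :=
          mul_le_mul_of_nonneg_left hs_norm hm0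
      _ = ‖s‖ * ‖mellin (errN P ρ) (-s)‖ := mul_comm _ _
      _ ≤ (|C| + 2 * ρ) * |t| ^ ε := hprod
  rw [← hsneg]
  have hK0 : 0 ≤ |C| + 2 * ρ := by positivity
  calc ‖mellin (errN P ρ) (-s)‖ ≤ (|C| + 2 * ρ) * |t| ^ (ε - 1) := hdiv
    _ ≤ (|C| + 2 * ρ) * (2 * (1 + |t|) ^ (ε - 1)) :=
        mul_le_mul_of_nonneg_left (rpow_sub_one_le_two_mul ht hε0 hε1) hK0
    _ = 2 * (|C| + 2 * ρ) * (1 + |t|) ^ (ε - 1) := by ring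

end Hilberdink

/-- **Hilberdink 2007, Theorem 1** (lower bound `μ_𝒫(σ) ≥ 1/2 − σ` for the Lindelöf function of
`ζ_𝒫` on `β < σ < 1/2`, under `N_𝒫(x) = ρx + O(x^β)`, `β < 1/2`, `ρ > 0`), discharging the named
fact `Hilberdink2007_thm1`: a bound `‖Z(σ+it)‖ ≤ C|t|^l` (`|t| ≥ T`) with `l < 1/2 − σ` would make
`‖∫₁^∞ E(x)x^{−σ−1+it}dx‖ ≤ K(1+|t|)^{ε−1}` for an `ε ∈ (0, 1/2 − σ)`, which the `L²` core of
Hilberdink 2005, Theorem 1 (`Hilberdink.false_of_mellin_bound`) forbids.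
[cite: Hilberdink2007, Theorem 1] -/
theorem Hilberdink2007_thm1_holds : Hilberdink2007_thm1 := by
  intro P ρ β hρ hβ hN Z hZ σ l hβσ hσ hl C T
  by_contra hcon
  push Not at hcon
  -- `β ≥ 0` is forced by the unit jumps of `N_P`
  have hβ0 : 0 ≤ β := by
    by_contra h
    push Not at h
    exact P.not_intErrorLE_of_neg h hN
  obtain ⟨CN, hCN⟩ := hN
  have hCN0 : 0 ≤ CN := Hilberdink.const_nonneg hCN
  -- `Z` is Landau's continuation on the line `Re s = σ`
  have heq : EqOn Z (P.intZeta ρ) {s : ℂ | β < s.re ∧ s ≠ 1} :=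
    hZ.eqOn (isZetaContinuation_intZeta (by linarith) hCN)
  have hZline : ∀ t : ℝ, Z (σ + t * I) = P.intZeta ρ (σ + t * I) := by
    intro t
    refine heq ⟨by simpa using hβσ, fun h ↦ ?_⟩
    have := congrArg Complex.re h
    simp at this
    linarith
  -- the exponent `ε = max(l, (1/2 − σ)/2) ∈ (0, 1/2 − σ)`, `l ≤ ε ≤ 1`
  set ε : ℝ := max l ((1 / 2 - σ) / 2) with hεdef
  have hε0 : 0 < ε := lt_of_lt_of_le (by linarith) (le_max_right _ _)
  have hσε : σ + ε < 1 / 2 := by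
    rcases le_total l ((1 / 2 - σ) / 2) with h | h
    · rw [hεdef, max_eq_right h]; linarith
    · rw [hεdef, max_eq_left h]; linarith
  have hlε : l ≤ ε := le_max_left _ _
  have hε1 : ε ≤ 1 := by linarith
  -- the constant
  set T' : ℝ := max T 1 with hT'
  have hT'1 : 1 ≤ T' := le_max_right _ _
  set K₁ : ℝ := 2 * (|C| + 2 * ρ) with hK₁
  set K₂ : ℝ := CN / (σ - β) * (1 + T') ^ (1 - ε) with hK₂
  have hK₁0 : 0 ≤ K₁ := by positivity
  have hK₂0 : 0 ≤ K₂ := by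
    have : 0 < σ - β := by linarith
    positivity
  have hK : ∀ t : ℝ, ‖mellin (Hilberdink.errN P ρ) (-σ + t * I)‖ ≤ (K₁ + K₂) * (1 + |t|) ^ (ε - 1) := by
    intro t
    have hpow0 : 0 < (1 + |t|) ^ (ε - 1) := Real.rpow_pos_of_pos (by positivity) _
    rcases le_or_gt T' |t| with ht | ht
    · -- large `|t|`: the hypothetical bound on `Z`
      have h := Hilberdink.norm_mellin_errN_le_of_zeta_bound hρ.le hZline hcon hlε hε0.le hε1
        ((le_max_left T 1).trans ht) (hT'1.trans ht)
      calc ‖mellin (Hilberdink.errN P ρ) (-σ + t * I)‖ ≤ K₁ * (1 + |t|) ^ (ε - 1) := h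
        _ ≤ (K₁ + K₂) * (1 + |t|) ^ (ε - 1) := by nlinarith
    · -- small `|t|`: the uniform bound `C_N/(σ − β)`
      set s : ℂ := σ + ((-t : ℝ) : ℂ) * I with hs
      have hsneg : -s = -σ + t * I := by rw [hs]; push_cast; ring
      have hsre : s.re = σ := by simp [hs]
      have h1 : ‖mellin (Hilberdink.errN P ρ) (-s)‖ ≤ CN / (s.re - β) :=
        Hilberdink.norm_mellin_errN_le hCN (by rw [hsre]; exact hβσ)
      rw [hsre] at h1
      -- `(1+|t|)^{ε−1} ≥ (1+T')^{ε−1}`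
      have h2 : (1 + T') ^ (ε - 1) ≤ (1 + |t|) ^ (ε - 1) :=
        Real.rpow_le_rpow_of_nonpos (by positivity) (by linarith) (by linarith)
      have h3 : CN / (σ - β) ≤ K₂ * (1 + |t|) ^ (ε - 1) := by
        have hσβ : 0 < σ - β := by linarith
        have hc0 : 0 ≤ CN / (σ - β) := div_nonneg hCN0 hσβ.le
        have hTpos : 0 < 1 + T' := by positivity
        have e : (1 + T') ^ (1 - ε) * (1 + T') ^ (ε - 1) = 1 := by
          rw [← Real.rpow_add hTpos]; norm_num
        calc CN / (σ - β) = CN / (σ - β) * ((1 + T') ^ (1 - ε) * (1 + T') ^ (ε - 1)) := by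
              rw [e, mul_one]
          _ = K₂ * (1 + T') ^ (ε - 1) := by rw [hK₂]; ring
          _ ≤ K₂ * (1 + |t|) ^ (ε - 1) := mul_le_mul_of_nonneg_left h2 hK₂0
      rw [← hsneg]
      calc ‖mellin (Hilberdink.errN P ρ) (-s)‖ ≤ CN / (σ - β) := h1
        _ ≤ K₂ * (1 + |t|) ^ (ε - 1) := h3
        _ ≤ (K₁ + K₂) * (1 + |t|) ^ (ε - 1) := by nlinarith
  exact Hilberdink.false_of_mellin_bound hρ hCN hβ0 hβσ hε0 hσε hK

end Literature.NumberTheory.BeurlingPrimes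

end
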